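import Summits.QuantumFields.BalabanUV.Beta.GAN24.CombLegRowsOfNaturalWindows
import Summits.QuantumFields.BalabanUV.Beta.GAN24.CombNaturalWindowH1
import Summits.QuantumFields.BalabanUV.Beta.GAN24.CombNaturalWindowShort
import Summits.QuantumFields.BalabanUV.Beta.GAN24.CombNaturalWindowDrift

/-!
# `BalabanUV.Beta.GAN24.CombLegRowsOfCombWindows` — binder row G-an2-4 ∕ (CONV-C), TRANSFER-III (the (α-0) chain at row D1's literal of record (III′)), row L11 (Q-L), THE W5 JUNCTION:
# **THE FOUR (Q-L) LEG ROWS `hL₁ hL₂ hL₁′ hL₂′` OF THE COMB-CHART `ε`-MEMBER AT `d = 3` FROM THE SOURCE LETTER ROWS `Hb ∕ Hbd` AND THE SLAVED SLOT-DIVERGENCE ROWS `Hh₁ Hh₂ Hh₁d Hh₂d`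
# ALONE — THE THREE NATURAL-WINDOW BINDERS `HW1 ∕ HWs ∕ HWΔ` OF gan24-formalise-leaf-03 g81's W4 `CombLegRowsOfNaturalWindows` DISCHARGED BY NAME** by the OWNER's eighth, ninth and twelfth
# words of the comb leg dictionary — `CombNaturalWindowH1.h1_window_of_combChart` ((H1♮) at (III′)), `CombNaturalWindowShort.short_windows_of_combChart` ((H1w)),
# `CombNaturalWindowDrift.drift_windows_of_combChart` ((H1Δw)) — at the pin `c := cE₂` under `2 ≤ Lc`, `|cE₂| ≤ Lc^{2(3+1)}`: ONE positional application of W4 (the gen-48 dry junction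
# `gen48/cert/Probe_W5_dry.5b1c3dd7711f49f6` rc 0 made a module).  This is the file leaf-03 g81 called W5 `CombLegRowsOfCombWindows` (its HOW-TO-WAKE v4 §C; first refusal honoured:
# the lineage is seatless since g81, LADDER-YM §3b(a)); typed by the OWNER `b2b-balaban-gan24-p1`, gen 49; no existing file touched.

NOT IN PRINT; OUR BOOKKEEPING ([folklore] composition BY NAME — one term; 0 `def`, 0 cited facts, 0 `def … : Prop`, 0 sorry).  HONEST FRAMING (cell contract, verbatim):
«discharging `BetaPertH` makes Bałaban's UV stability UNCONDITIONAL — a real constructive-QFT result; it is NOT the continuum limit and NOT the Clay problem.»  HONEST DEPENDENCY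
(verbatim): «continuum YM on T⁴ ⇐ BetaPertH ∧ nine spine estimates (0/9 proved); BetaPertH ⇐ (D1) ∧ (D4) ∧ CAP+tail; G-an2-4 gates asym, D1 and NE2/3/4.»

WHAT (`d = 3`, `2 ≤ Lc`, ANY `tabs : SymTables 3 Lc` with off-diagonal border `hBff hBmm`, every `cE cVH cΛ cB Tc`, the pinned `cE₂` (`|cE₂| ≤ Lc^{2(3+1)}`), every `ε` with `ε·ε = 1`;
`T̃′_n := T2RecOf 3 Lc (GcombSh Lc) (SpureCombOf tabs cE cVH cΛ) tabs.M cE₂ cB Tc tabs.vh₂S tabs.mixFF n`, `y′_n := ½ • (T̃′♮_n + ε • P T̃′♮_n)`):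
**`exists_legRows_halfMember_comb_three_of_combWindows`** — `∃ δ CL c ϑ, 0 < δ ∧ 0 ≤ c ∧ 0 < ϑ < 1 ∧ (∀ l, hL₁ (y′_l) CL δ) ∧ (∀ l, hL₂ (y′_l) CL δ) ∧ (∀ l, hL₁′ (c·ϑ^l) δ) ∧ (∀ l, hL₂′ (c·ϑ^l) δ)`
— W4's conclusion VERBATIM (the four rows in the spelling of leaf-03's (C-6d) `CombHalfMemberCellDriftOfDivergences.comb_cellDrift_rows_of_divergence_rows` at `Z l := y′_l` and of
gan24-formalise-leaf-01 g82's F7 `CombT2DriftHalfMemberOfDivergences` binders `hL₁ hL₂ hL₁' hL₂'`) — from EXACTLY the source letter rows `Hb` (`LocStencil₂ b̃′♮_n Cb δ6`), `Hbd`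
(`LocStencil₂ (b̃′♮_{l+1} − b̃′♮_l) (cb·θb^l) δ6`) and the slaved slot-divergence rows `Hh₁ Hh₂ Hh₁d Hh₂d` of the members (W4's lines 168–183 token for token).
READING (zero weight).  After this file the LEG side of the (III′) column displays NO window: `Hb ∕ Hbd` ⟸ the S-slot rows of `ScombOf` (leaf-01 g82's F10b `CombT2RecSourceRows`),
`Hh₁ … Hh₂d` ⟸ table laws + parities, the S-slot rows, two scalar rows (leaf-01 g82's F4 `CombSlavedDivRowsAtRecord` §2).  Asserts NO shape of Bałaban's tables beyond the displayed
rows and NO value of any charge; discharges NO slot ∕ letter ∕ source row of the (III′) campaign (NOT asked, an2 W-4 l.64553); NOT «(Q-L) closed» as a value; NEVER «G-an2-4 closed»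
as (CONV-C); NOT D1, NOT `BetaPertH`, NOT continuum, NOT Clay; not in print.  Unit `b2b-balaban-gan24-p1` (OWNER, gen 49), 2026-08-26.
-/

noncomputable section

open Finset
open scoped BigOperators
open Literature.MathematicalPhysics.QuantumFieldTheory
open Literature.MathematicalPhysics.QuantumFieldTheory.Balaban1983to89
open Literature.MathematicalPhysics.QuantumFieldTheory.Balaban1983to89.Beta
open OneStepResolventKernel (Fib)
open SecondOrderResponse (W2SymOfK)
open KernelWard (divV)
open BalabanCompositeJets (LocStencil₂)
open BalabanStepJetsSucc (mmRead)
open BalabanStepW2 (K3OfK M2Of)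
open Summit.QuantumFields.BalabanUV.Beta.TameKernelCalculus (trK)
open Summit.QuantumFields.BalabanUV.Beta.BorderedHessian (sgnK)
open Summit.QuantumFields.BalabanUV.Beta.HessKerDressedUnits (unitK unitS)
open Summit.QuantumFields.BalabanUV.Beta.SecondOrderUnits (unitM unitS₂ unitM₂)
open Summit.QuantumFields.BalabanUV.Beta.SpineRooted (T2RecOf)
open Summit.QuantumFields.BalabanUV.Beta.SymmetrisedStepJets (SymTables)
open Summit.QuantumFields.BalabanUV.Beta.CombChartStepJets (GcombSh SpureCombOf)
open Summit.QuantumFields.BalabanUV.Beta.GAN24.CombesThomas (sfStep smStep)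
open Summit.QuantumFields.BalabanUV.Beta.GAN24.CombLegRowsOfNaturalWindows (exists_legRows_halfMember_comb_three_of_naturalWindows)
open Summit.QuantumFields.BalabanUV.Beta.GAN24.CombNaturalWindowH1 (h1_window_of_combChart)
open Summit.QuantumFields.BalabanUV.Beta.GAN24.CombNaturalWindowShort (short_windows_of_combChart)
open Summit.QuantumFields.BalabanUV.Beta.GAN24.CombNaturalWindowDrift (drift_windows_of_combChart)

namespace Summit.QuantumFields.BalabanUV.Beta.GAN24.CombLegRowsOfCombWindows

variable {Lc : ℕ} [NeZero Lc]

/-- NOT IN PRINT; OUR BOOKKEEPING.  **THE W5 JUNCTION — THE FOUR (Q-L) LEG ROWS OF THE COMB-CHART `ε`-MEMBER AT `d = 3` FROM `Hb ∕ Hbd` AND `Hh₁ … Hh₂d` ALONE** (as displayed in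
the module docstring): gan24-formalise-leaf-03 g81's W4 `exists_legRows_halfMember_comb_three_of_naturalWindows` with `HW1 ∕ HWs ∕ HWΔ` := the OWNER's words 8 ∕ 9 ∕ 12 at `c := cE₂`. -/
theorem exists_legRows_halfMember_comb_three_of_combWindows (hLc : 2 ≤ Lc) (tabs : SymTables 3 Lc) (cE cVH cΛ cE₂ cB : ℝ)
    (hcE₂ : |cE₂| ≤ (Lc : ℝ) ^ (2 * (3 + 1)))
    (Tc : Fin 4 → Fin 4 → Fin 4 → Fin 4 → ℝ)
    (hBff : ∀ κ u κ' u' x z (α β : Fin (3 + 1)), tabs.vh₂S κ u κ' u' x z (Sum.inl α) (Sum.inl β) = 0)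
    (hBmm : ∀ κ u κ' u' x z (μ ν : Fin (3 + 1)), tabs.vh₂S κ u κ' u' x z (Sum.inr μ) (Sum.inr ν) = 0) {ε : ℝ} (hε : ε * ε = 1)
    {δ6 Cb cb θb : ℝ} (hδ6 : 0 < δ6) (hθb0 : 0 ≤ θb) (hθb1 : θb < 1)
    (Hb : ∀ n : ℕ, LocStencil₂ (fun κ u κ' u' => (cE₂ * (Lc : ℝ) ^ (2 * (3 + 1))) • mmRead Lc (K3OfK (unitK (sfStep Lc n) (smStep 3 Lc n) (GcombSh (d := 3) Lc n)) Lc (unitS (sfStep Lc n) (smStep 3 Lc n) (SpureCombOf tabs cE cVH cΛ n)) (unitM (sfStep Lc n) (smStep 3 Lc n) (tabs.M n)) (W2SymOfK (unitK (sfStep Lc n) (smStep 3 Lc n) (GcombSh (d := 3) Lc n)) Lc (unitS (sfStep Lc n) (smStep 3 Lc n) (SpureCombOf tabs cE cVH cΛ n)) (unitM (sfStep Lc n) (smStep 3 Lc n) (tabs.M n)) 0 (unitM₂ (sfStep Lc n) (smStep 3 Lc n) (M2Of 3 Lc tabs.mixFF n))) κ u κ' u') + cB • tabs.vh₂S κ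 u κ' u') Cb δ6)
    (Hbd : ∀ l : ℕ, LocStencil₂ ((fun κ u κ' u' => (cE₂ * (Lc : ℝ) ^ (2 * (3 + 1))) • mmRead Lc (K3OfK (unitK (sfStep Lc (l + 1)) (smStep 3 Lc (l + 1)) (GcombSh (d := 3) Lc (l + 1))) Lc (unitS (sfStep Lc (l + 1)) (smStep 3 Lc (l + 1)) (SpureCombOf tabs cE cVH cΛ (l + 1))) (unitM (sfStep Lc (l + 1)) (smStep 3 Lc (l + 1)) (tabs.M (l + 1))) (W2SymOfK (unitK (sfStep Lc (l + 1)) (smStep 3 Lc (l + 1)) (GcombSh (d := 3) Lc (l + 1))) Lc (unitS (sfStep Lc (l + 1)) (smStep 3 Lc (l + 1)) (SpureCombOf tabs cE cVH cΛ (l + 1))) (unitM (sfStep Lc (l + 1)) (smStep 3 Lc (l + 1)) (tabs.M (l + 1))) 0 (unitM₂ (sfStep Lc (l + 1)) (smStep 3 Lc (l + 1)) (M2Of 3 Lc tabs.mixFF (l + 1)))) κ u κ' u') + cB • tabs.vh₂S κ u κ' u')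
      - (fun κ u κ' u' => (cE₂ * (Lc : ℝ) ^ (2 * (3 + 1))) • mmRead Lc (K3OfK (unitK (sfStep Lc l) (smStep 3 Lc l) (GcombSh (d := 3) Lc l)) Lc (unitS (sfStep Lc l) (smStep 3 Lc l) (SpureCombOf tabs cE cVH cΛ l)) (unitM (sfStep Lc l) (smStep 3 Lc l) (tabs.M l)) (W2SymOfK (unitK (sfStep Lc l) (smStep 3 Lc l) (GcombSh (d := 3) Lc l)) Lc (unitS (sfStep Lc l) (smStep 3 Lc l) (SpureCombOf tabs cE cVH cΛ l)) (unitM (sfStep Lc l) (smStep 3 Lc l) (tabs.M l)) 0 (unitM₂ (sfStep Lc l) (smStep 3 Lc l) (M2Of 3 Lc tabs.mixFF l))) κ u κ' u') + cB • tabs.vh₂S κ u κ' u')) (cb * θb ^ l) δ6)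
    {δ₃ σ₁ σ₂ σ₁d σ₂d ν₃ : ℝ} (hδ₃ : 0 < δ₃) (hν₃0 : 0 ≤ ν₃) (hν₃1 : ν₃ < 1)
    (Hh₁ : ∀ n : ℕ, LocStencil₂ (fun (_ : Fin (3 + 1)) (p : Fin (3 + 1) → ℤ) (κ' : Fin (3 + 1)) (u' : Fin (3 + 1) → ℤ) =>
      divV (fun κ₁ u₁ => (((1 : ℝ) / 2) • (unitS₂ (sfStep Lc n) (smStep 3 Lc n) (T2RecOf 3 Lc (GcombSh Lc) (SpureCombOf tabs cE cVH cΛ) tabs.M cE₂ cB Tc tabs.vh₂S tabs.mixFF n) + ε • fun κ u κ' u' => sgnK (trK ((unitS₂ (sfStep Lc n) (smStep 3 Lc n) (T2RecOf 3 Lc (GcombSh Lc) (SpureCombOf tabs cE cVH cΛ) tabs.M cE₂ cB Tc tabs.vh₂S tabs.mixFF n)) κ u κ' u')))) κ₁ u₁ κ' u') p) σ₁ δ₃)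
    (Hh₂ : ∀ n : ℕ, LocStencil₂ (fun (κ : Fin (3 + 1)) (u : Fin (3 + 1) → ℤ) (_ : Fin (3 + 1)) (p : Fin (3 + 1) → ℤ) =>
      divV (fun κ₁ u₁ => (((1 : ℝ) / 2) • (unitS₂ (sfStep Lc n) (smStep 3 Lc n) (T2RecOf 3 Lc (GcombSh Lc) (SpureCombOf tabs cE cVH cΛ) tabs.M cE₂ cB Tc tabs.vh₂S tabs.mixFF n) + ε • fun κ u κ' u' => sgnK (trK ((unitS₂ (sfStep Lc n) (smStep 3 Lc n) (T2RecOf 3 Lc (GcombSh Lc) (SpureCombOf tabs cE cVH cΛ) tabs.M cE₂ cB Tc tabs.vh₂S tabs.mixFF n)) κ u κ' u')))) κ u κ₁ u₁) p) σ₂ δ₃)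
    (Hh₁d : ∀ n : ℕ, LocStencil₂ (fun (_ : Fin (3 + 1)) (p : Fin (3 + 1) → ℤ) (κ' : Fin (3 + 1)) (u' : Fin (3 + 1) → ℤ) =>
      divV (fun κ₁ u₁ => ((((1 : ℝ) / 2) • (unitS₂ (sfStep Lc (n + 1)) (smStep 3 Lc (n + 1)) (T2RecOf 3 Lc (GcombSh Lc) (SpureCombOf tabs cE cVH cΛ) tabs.M cE₂ cB Tc tabs.vh₂S tabs.mixFF (n + 1)) + ε • fun κ u κ' u' => sgnK (trK ((unitS₂ (sfStep Lc (n + 1)) (smStep 3 Lc (n + 1)) (T2RecOf 3 Lc (GcombSh Lc) (SpureCombOf tabs cE cVH cΛ) tabs.M cE₂ cB Tc tabs.vh₂S tabs.mixFF (n + 1))) κ u κ' u'))))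
        - (((1 : ℝ) / 2) • (unitS₂ (sfStep Lc n) (smStep 3 Lc n) (T2RecOf 3 Lc (GcombSh Lc) (SpureCombOf tabs cE cVH cΛ) tabs.M cE₂ cB Tc tabs.vh₂S tabs.mixFF n) + ε • fun κ u κ' u' => sgnK (trK ((unitS₂ (sfStep Lc n) (smStep 3 Lc n) (T2RecOf 3 Lc (GcombSh Lc) (SpureCombOf tabs cE cVH cΛ) tabs.M cE₂ cB Tc tabs.vh₂S tabs.mixFF n)) κ u κ' u'))))) κ₁ u₁ κ' u') p) (σ₁d * ν₃ ^ n) δ₃)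
    (Hh₂d : ∀ n : ℕ, LocStencil₂ (fun (κ : Fin (3 + 1)) (u : Fin (3 + 1) → ℤ) (_ : Fin (3 + 1)) (p : Fin (3 + 1) → ℤ) =>
      divV (fun κ₁ u₁ => ((((1 : ℝ) / 2) • (unitS₂ (sfStep Lc (n + 1)) (smStep 3 Lc (n + 1)) (T2RecOf 3 Lc (GcombSh Lc) (SpureCombOf tabs cE cVH cΛ) tabs.M cE₂ cB Tc tabs.vh₂S tabs.mixFF (n + 1)) + ε • fun κ u κ' u' => sgnK (trK ((unitS₂ (sfStep Lc (n + 1)) (smStep 3 Lc (n + 1)) (T2RecOf 3 Lc (GcombSh Lc) (SpureCombOf tabs cE cVH cΛ) tabs.M cE₂ cB Tc tabs.vh₂S tabs.mixFF (n + 1))) κ u κ' u'))))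
        - (((1 : ℝ) / 2) • (unitS₂ (sfStep Lc n) (smStep 3 Lc n) (T2RecOf 3 Lc (GcombSh Lc) (SpureCombOf tabs cE cVH cΛ) tabs.M cE₂ cB Tc tabs.vh₂S tabs.mixFF n) + ε • fun κ u κ' u' => sgnK (trK ((unitS₂ (sfStep Lc n) (smStep 3 Lc n) (T2RecOf 3 Lc (GcombSh Lc) (SpureCombOf tabs cE cVH cΛ) tabs.M cE₂ cB Tc tabs.vh₂S tabs.mixFF n)) κ u κ' u'))))) κ u κ₁ u₁) p) (σ₂d * ν₃ ^ n) δ₃) :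
    ∃ δ CL c ϑ : ℝ, 0 < δ ∧ 0 ≤ c ∧ 0 < ϑ ∧ ϑ < 1 ∧
      (∀ l, LocStencil₂ (fun κ u κ' u' => fun (p z : Fin (3 + 1) → ℤ) (_ : Fib 3) (b : Fib 3) =>
        ∑ β : Fin (3 + 1), ((((1 : ℝ) / 2) • (unitS₂ (sfStep Lc l) (smStep 3 Lc l) (T2RecOf 3 Lc (GcombSh Lc) (SpureCombOf tabs cE cVH cΛ) tabs.M cE₂ cB Tc tabs.vh₂S tabs.mixFF l) + ε • fun κ u κ' u' => sgnK (trK ((unitS₂ (sfStep Lc l) (smStep 3 Lc l) (T2RecOf 3 Lc (GcombSh Lc) (SpureCombOf tabs cE cVH cΛ) tabs.M cE₂ cB Tc tabs.vh₂S tabs.mixFF l)) κ u κ' u')))) κ u κ' u' p z (Sum.inl β) b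
          - (((1 : ℝ) / 2) • (unitS₂ (sfStep Lc l) (smStep 3 Lc l) (T2RecOf 3 Lc (GcombSh Lc) (SpureCombOf tabs cE cVH cΛ) tabs.M cE₂ cB Tc tabs.vh₂S tabs.mixFF l) + ε • fun κ u κ' u' => sgnK (trK ((unitS₂ (sfStep Lc l) (smStep 3 Lc l) (T2RecOf 3 Lc (GcombSh Lc) (SpureCombOf tabs cE cVH cΛ) tabs.M cE₂ cB Tc tabs.vh₂S tabs.mixFF l)) κ u κ' u')))) κ u κ' u' (p - AffineAveraging.unitVec β) z (Sum.inl β) b)) CL δ) ∧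
      (∀ l, LocStencil₂ (fun κ u κ' u' => fun (x p : Fin (3 + 1) → ℤ) (a : Fib 3) (_ : Fib 3) =>
        ∑ β : Fin (3 + 1), ((((1 : ℝ) / 2) • (unitS₂ (sfStep Lc l) (smStep 3 Lc l) (T2RecOf 3 Lc (GcombSh Lc) (SpureCombOf tabs cE cVH cΛ) tabs.M cE₂ cB Tc tabs.vh₂S tabs.mixFF l) + ε • fun κ u κ' u' => sgnK (trK ((unitS₂ (sfStep Lc l) (smStep 3 Lc l) (T2RecOf 3 Lc (GcombSh Lc) (SpureCombOf tabs cE cVH cΛ) tabs.M cE₂ cB Tc tabs.vh₂S tabs.mixFF l)) κ u κ' u')))) κ u κ' u' x p a (Sum.inl β)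
          - (((1 : ℝ) / 2) • (unitS₂ (sfStep Lc l) (smStep 3 Lc l) (T2RecOf 3 Lc (GcombSh Lc) (SpureCombOf tabs cE cVH cΛ) tabs.M cE₂ cB Tc tabs.vh₂S tabs.mixFF l) + ε • fun κ u κ' u' => sgnK (trK ((unitS₂ (sfStep Lc l) (smStep 3 Lc l) (T2RecOf 3 Lc (GcombSh Lc) (SpureCombOf tabs cE cVH cΛ) tabs.M cE₂ cB Tc tabs.vh₂S tabs.mixFF l)) κ u κ' u')))) κ u κ' u' x (p - AffineAveraging.unitVec β) a (Sum.inl β))) CL δ) ∧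
      (∀ l, LocStencil₂ (fun κ u κ' u' => fun (p z : Fin (3 + 1) → ℤ) (_ : Fib 3) (b : Fib 3) =>
        ∑ β : Fin (3 + 1), (((((1 : ℝ) / 2) • (unitS₂ (sfStep Lc (l + 1)) (smStep 3 Lc (l + 1)) (T2RecOf 3 Lc (GcombSh Lc) (SpureCombOf tabs cE cVH cΛ) tabs.M cE₂ cB Tc tabs.vh₂S tabs.mixFF (l + 1)) + ε • fun κ u κ' u' => sgnK (trK ((unitS₂ (sfStep Lc (l + 1)) (smStep 3 Lc (l + 1)) (T2RecOf 3 Lc (GcombSh Lc) (SpureCombOf tabs cE cVH cΛ) tabs.M cE₂ cB Tc tabs.vh₂S tabs.mixFF (l + 1))) κ u κ' u'))))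
          - (((1 : ℝ) / 2) • (unitS₂ (sfStep Lc l) (smStep 3 Lc l) (T2RecOf 3 Lc (GcombSh Lc) (SpureCombOf tabs cE cVH cΛ) tabs.M cE₂ cB Tc tabs.vh₂S tabs.mixFF l) + ε • fun κ u κ' u' => sgnK (trK ((unitS₂ (sfStep Lc l) (smStep 3 Lc l) (T2RecOf 3 Lc (GcombSh Lc) (SpureCombOf tabs cE cVH cΛ) tabs.M cE₂ cB Tc tabs.vh₂S tabs.mixFF l)) κ u κ' u'))))) κ u κ' u' p z (Sum.inl β) b
          - ((((1 : ℝ) / 2) • (unitS₂ (sfStep Lc (l + 1)) (smStep 3 Lc (l + 1)) (T2RecOf 3 Lc (GcombSh Lc) (SpureCombOf tabs cE cVH cΛ) tabs.M cE₂ cB Tc tabs.vh₂S tabs.mixFF (l + 1)) + ε • fun κ u κ' u' => sgnK (trK ((unitS₂ (sfStep Lc (l + 1)) (smStep 3 Lc (l + 1)) (T2RecOf 3 Lc (GcombSh Lc) (SpureCombOf tabs cE cVH cΛ) tabs.M cE₂ cB Tc tabs.vh₂S tabs.mixFF (l + 1))) κ u κ' u'))))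
          - (((1 : ℝ) / 2) • (unitS₂ (sfStep Lc l) (smStep 3 Lc l) (T2RecOf 3 Lc (GcombSh Lc) (SpureCombOf tabs cE cVH cΛ) tabs.M cE₂ cB Tc tabs.vh₂S tabs.mixFF l) + ε • fun κ u κ' u' => sgnK (trK ((unitS₂ (sfStep Lc l) (smStep 3 Lc l) (T2RecOf 3 Lc (GcombSh Lc) (SpureCombOf tabs cE cVH cΛ) tabs.M cE₂ cB Tc tabs.vh₂S tabs.mixFF l)) κ u κ' u'))))) κ u κ' u' (p - AffineAveraging.unitVec β) z (Sum.inl β) b)) (c * ϑ ^ l) δ) ∧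
      (∀ l, LocStencil₂ (fun κ u κ' u' => fun (x p : Fin (3 + 1) → ℤ) (a : Fib 3) (_ : Fib 3) =>
        ∑ β : Fin (3 + 1), (((((1 : ℝ) / 2) • (unitS₂ (sfStep Lc (l + 1)) (smStep 3 Lc (l + 1)) (T2RecOf 3 Lc (GcombSh Lc) (SpureCombOf tabs cE cVH cΛ) tabs.M cE₂ cB Tc tabs.vh₂S tabs.mixFF (l + 1)) + ε • fun κ u κ' u' => sgnK (trK ((unitS₂ (sfStep Lc (l + 1)) (smStep 3 Lc (l + 1)) (T2RecOf 3 Lc (GcombSh Lc) (SpureCombOf tabs cE cVH cΛ) tabs.M cE₂ cB Tc tabs.vh₂S tabs.mixFF (l + 1))) κ u κ' u'))))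
          - (((1 : ℝ) / 2) • (unitS₂ (sfStep Lc l) (smStep 3 Lc l) (T2RecOf 3 Lc (GcombSh Lc) (SpureCombOf tabs cE cVH cΛ) tabs.M cE₂ cB Tc tabs.vh₂S tabs.mixFF l) + ε • fun κ u κ' u' => sgnK (trK ((unitS₂ (sfStep Lc l) (smStep 3 Lc l) (T2RecOf 3 Lc (GcombSh Lc) (SpureCombOf tabs cE cVH cΛ) tabs.M cE₂ cB Tc tabs.vh₂S tabs.mixFF l)) κ u κ' u'))))) κ u κ' u' x p a (Sum.inl β)
          - ((((1 : ℝ) / 2) • (unitS₂ (sfStep Lc (l + 1)) (smStep 3 Lc (l + 1)) (T2RecOf 3 Lc (GcombSh Lc) (SpureCombOf tabs cE cVH cΛ) tabs.M cE₂ cB Tc tabs.vh₂S tabs.mixFF (l + 1)) + ε • fun κ u κ' u' => sgnK (trK ((unitS₂ (sfStep Lc (l + 1)) (smStep 3 Lc (l + 1)) (T2RecOf 3 Lc (GcombSh Lc) (SpureCombOf tabs cE cVH cΛ) tabs.M cE₂ cB Tc tabs.vh₂S tabs.mixFF (l + 1))) κ u κ' u'))))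
          - (((1 : ℝ) / 2) • (unitS₂ (sfStep Lc l) (smStep 3 Lc l) (T2RecOf 3 Lc (GcombSh Lc) (SpureCombOf tabs cE cVH cΛ) tabs.M cE₂ cB Tc tabs.vh₂S tabs.mixFF l) + ε • fun κ u κ' u' => sgnK (trK ((unitS₂ (sfStep Lc l) (smStep 3 Lc l) (T2RecOf 3 Lc (GcombSh Lc) (SpureCombOf tabs cE cVH cΛ) tabs.M cE₂ cB Tc tabs.vh₂S tabs.mixFF l)) κ u κ' u'))))) κ u κ' u' x (p - AffineAveraging.unitVec β) a (Sum.inl β))) (c * ϑ ^ l) δ) :=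
  exists_legRows_halfMember_comb_three_of_naturalWindows tabs cE cVH cΛ cE₂ cB Tc hBff hBmm hε
    (h1_window_of_combChart hLc hcE₂)
    (short_windows_of_combChart hLc hcE₂)
    (drift_windows_of_combChart hLc hcE₂)
    hδ6 hθb0 hθb1 Hb Hbd hδ₃ hν₃0 hν₃1 Hh₁ Hh₂ Hh₁d Hh₂d

end Summit.QuantumFields.BalabanUV.Beta.GAN24.CombLegRowsOfCombWindows

end
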